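import Summits.QuantumAdvantage.QuantumAdvantage.Theses.RandomOracleGauge
import Literature.Computability.QuantumComplexity.InfluenceBounds

/-!
# Crux `OneBlockDecoupling` (stmt-QuantumAdvantage-17873, route RandomOracleGauge), line `odonnell-zhao` — stub `stub_realisation`

O'Donnell–Zhao, *Polynomial bounds for decoupling, with applications*, arXiv:1512.01603, proof of Thm. 2.13:
the one-block-decoupled function of a polynomial `p` on `{0,1}^N`,

  `dec p (y,z) = Σ_S p̂(S) Σ_{i∈S} sgn(y_i) Π_{j∈S∖i} sgn(z_j)`   (`p̂ = cubeFourierCoeff (evalBool p)`),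

rescaled as `1/2 + dec p/(2C)` with `|dec p| ≤ C`, IS the cube function of an honest polynomial
`q ∈ ℝ[Fin (N+N)]` (blocks `y` = `Fin.castAdd N`, `z` = `Fin.natAdd N`, glued by `Fin.append`) which is
`[0,1]`-bounded, ONE-BLOCK-DECOUPLED (`q(y,z) = c₀ + Σ_i (±1)^{y_i} g_i(z)`), and of total degree `≤ d`
whenever `p.totalDegree ≤ d` — the last point because a polynomial of total degree `≤ d` has no Walsh
coefficient above level `d` (`cubeFourierCoeff_evalBool_eq_zero`), so every summand
`p̂(S)·sgnX(yᵢ)·Π_{j∈S∖i} sgnX(z_j)` either vanishes or has degree `|S| ≤ d`.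

* the witness `decPoly = 1/2 + (1/2C) Σ_S p̂(S) Σ_{i∈S} (1 − 2Y_i) Π_{j∈S∖i} (1 − 2Z_j)` (written inline, def-free);
* `evalBool_decPoly_append`, `totalDegree_decPoly_le`, `decPoly_bounds`, `decPoly_decoupled`;
* **`stub_realisation`** — the registered stub of `Cruxes/AAConj/Lines/odonnell_zhao.lean`, BY NAME and with
  its registered signature.

All elementary (`MvPolynomial.eval` is a ring morphism; degree bookkeeping); no named facts.
-/

-- D-0017: single-conjunct summit ⇒ the duplicate `QuantumAdvantage.QuantumAdvantage` is mandated.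
set_option linter.dupNamespace false

noncomputable section

open Finset
open Literature.Computability.QuantumComplexity
open Literature.Probability.RandomGraphs.LowDegree (sgn walsh)
open Literature.Computability.Complexity.LowDegree (cubeFourierCoeff)
open Summit.QuantumAdvantage.QuantumAdvantage.Theses.RandomOracleGauge

namespace Summit.QuantumAdvantage.QuantumAdvantage.Cruxes.OneBlockDecoupling.OdonnellZhao

namespace StubRealisation

variable {M : ℕ}

/-! ### The `±1` sign polynomial of a variable -/

/-- `(1 − 2X_k)(x) = sgn (x k)` on the cube. [folklore] -/
theorem evalBool_sgnX (k : Fin M) (x : Fin M → Bool) :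
    evalBool (1 - MvPolynomial.C 2 * MvPolynomial.X k) x = sgn (x k) := by
  unfold evalBool
  simp only [map_sub, map_one, map_mul, MvPolynomial.eval_C, MvPolynomial.eval_X]
  cases x k <;> norm_num [sgn]

/-- `deg (1 − 2X_k) ≤ 1`. [folklore] -/
theorem totalDegree_sgnX_le (k : Fin M) :
    (1 - MvPolynomial.C 2 * MvPolynomial.X k : MvPolynomial (Fin M) ℝ).totalDegree ≤ 1 := by
  refine (MvPolynomial.totalDegree_sub _ _).trans (max_le ?_ ?_)
  · simp
  · exact (MvPolynomial.totalDegree_mul _ _).trans (by simp [MvPolynomial.totalDegree_X])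

/-- `sgn b = −(±1)^b` in the `if b then 1 else −1` spelling of the route file. [folklore] -/
theorem sgn_eq_neg_ite (b : Bool) : sgn b = -(if b then (1 : ℝ) else -1) := by
  cases b <;> simp [sgn]

/-! ### The witness polynomial -/

variable {N : ℕ}

/-! The witness (O'Donnell–Zhao's `(1 + f̃/C)/2` for `f = 2p − 1`) is written out INLINE in every statement
below (no new definition in a proof file):
`decPoly p K := 1/2 + (1/2K) Σ_S p̂(S) Σ_{i∈S} (1 − 2X_{castAdd i}) Π_{j∈S∖i} (1 − 2X_{natAdd j})` on `Fin (N+N)`,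
the `y`-block being `Fin.castAdd N` and the `z`-block `Fin.natAdd N`. -/

/-- The cube value of `decPoly p K` at the glued point `(y,z)` is `1/2 + dec p (y,z)/(2K)`. [cite: ODonnellZhao2016, Def. 1.1] -/
theorem evalBool_decPoly_append (p : MvPolynomial (Fin N) ℝ) (K : ℝ) (y z : Fin N → Bool) :
    evalBool (MvPolynomial.C (1 / 2) + MvPolynomial.C (1 / (2 * K)) *
      ∑ S : Finset (Fin N), MvPolynomial.C (cubeFourierCoeff (evalBool p) S) *
        ∑ i ∈ S, (1 - MvPolynomial.C 2 * MvPolynomial.X (Fin.castAdd N i)) *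
          ∏ j ∈ S.erase i, (1 - MvPolynomial.C 2 * MvPolynomial.X (Fin.natAdd N j)) :
      MvPolynomial (Fin (N + N)) ℝ) (Fin.append y z) =
      1 / 2 + (∑ S : Finset (Fin N), cubeFourierCoeff (evalBool p) S *
        ∑ i ∈ S, sgn (y i) * ∏ j ∈ S.erase i, sgn (z j)) / (2 * K) := by
  have hev : ∀ q : MvPolynomial (Fin (N + N)) ℝ, evalBool q (Fin.append y z) =
      MvPolynomial.eval (fun k => if Fin.append y z k then (1 : ℝ) else 0) q := fun _ => rfl
  have hy : ∀ i : Fin N, MvPolynomial.eval (fun k => if Fin.append y z k then (1 : ℝ) else 0)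
      (1 - MvPolynomial.C 2 * MvPolynomial.X (Fin.castAdd N i)) = sgn (y i) := by
    intro i; rw [← hev, evalBool_sgnX, Fin.append_left]
  have hz : ∀ j : Fin N, MvPolynomial.eval (fun k => if Fin.append y z k then (1 : ℝ) else 0)
      (1 - MvPolynomial.C 2 * MvPolynomial.X (Fin.natAdd N j)) = sgn (z j) := by
    intro j; rw [← hev, evalBool_sgnX, Fin.append_right]
  rw [hev]
  simp only [map_add, map_mul, MvPolynomial.eval_C, map_sum, map_prod, hy, hz]
  ring

/-- Every point of the `(N+N)`-cube is a glued point. [folklore] -/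
theorem eq_append (x : Fin (N + N) → Bool) :
    x = Fin.append (fun i => x (Fin.castAdd N i)) (fun j => x (Fin.natAdd N j)) := by
  funext k
  refine Fin.addCases (fun i => ?_) (fun j => ?_) k
  · rw [Fin.append_left]
  · rw [Fin.append_right]

/-- Degree bookkeeping: `deg decPoly ≤ d` when `p.totalDegree ≤ d` (summands above level `d` vanish,
the others have degree `|S| ≤ d`). [cite: ODonnellZhao2016, proof of Thm. 2.13] -/
theorem totalDegree_decPoly_le {p : MvPolynomial (Fin N) ℝ} {d : ℕ} (hp : p.totalDegree ≤ d) (K : ℝ) :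
    (MvPolynomial.C (1 / 2) + MvPolynomial.C (1 / (2 * K)) *
      ∑ S : Finset (Fin N), MvPolynomial.C (cubeFourierCoeff (evalBool p) S) *
        ∑ i ∈ S, (1 - MvPolynomial.C 2 * MvPolynomial.X (Fin.castAdd N i)) *
          ∏ j ∈ S.erase i, (1 - MvPolynomial.C 2 * MvPolynomial.X (Fin.natAdd N j)) :
      MvPolynomial (Fin (N + N)) ℝ).totalDegree ≤ d := by
  classical
  refine (MvPolynomial.totalDegree_add _ _).trans (max_le (by simp) ?_)
  refine (MvPolynomial.totalDegree_mul _ _).trans ?_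
  rw [MvPolynomial.totalDegree_C, zero_add]
  refine (MvPolynomial.totalDegree_finsetSum _ _).trans (Finset.sup_le fun S _ => ?_)
  by_cases hS : d < S.card
  · -- above level `d` the coefficient vanishes
    rw [cubeFourierCoeff_evalBool_eq_zero hp hS, MvPolynomial.C_0, zero_mul, MvPolynomial.totalDegree_zero]
    exact Nat.zero_le _
  · push Not at hS
    refine (MvPolynomial.totalDegree_mul _ _).trans ?_
    rw [MvPolynomial.totalDegree_C, zero_add]
    refine (MvPolynomial.totalDegree_finsetSum _ _).trans (Finset.sup_le fun i hi => ?_)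
    refine (MvPolynomial.totalDegree_mul _ _).trans ?_
    refine (add_le_add (totalDegree_sgnX_le _) ((MvPolynomial.totalDegree_finsetProd _ _).trans
      (Finset.sum_le_sum fun j _ => totalDegree_sgnX_le (Fin.natAdd N j)))).trans ?_
    rw [Finset.sum_const, smul_eq_mul, mul_one, Finset.card_erase_of_mem hi]
    have h1 : 1 ≤ S.card := Finset.card_pos.mpr ⟨i, hi⟩
    omega

/-- Boundedness: if `|dec p| ≤ K` pointwise (`K > 0`) then `0 ≤ decPoly p K ≤ 1` on the cube. [folklore] -/
theorem decPoly_bounds {p : MvPolynomial (Fin N) ℝ} {K : ℝ} (hK : 0 < K)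
    (hb : ∀ (y z : Fin N → Bool),
      |∑ S : Finset (Fin N), cubeFourierCoeff (evalBool p) S *
          ∑ i ∈ S, sgn (y i) * ∏ j ∈ S.erase i, sgn (z j)| ≤ K)
    (x : Fin (N + N) → Bool) :
    0 ≤ evalBool (MvPolynomial.C (1 / 2) + MvPolynomial.C (1 / (2 * K)) *
      ∑ S : Finset (Fin N), MvPolynomial.C (cubeFourierCoeff (evalBool p) S) *
        ∑ i ∈ S, (1 - MvPolynomial.C 2 * MvPolynomial.X (Fin.castAdd N i)) *
          ∏ j ∈ S.erase i, (1 - MvPolynomial.C 2 * MvPolynomial.X (Fin.natAdd N j)) :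
      MvPolynomial (Fin (N + N)) ℝ) x ∧
    evalBool (MvPolynomial.C (1 / 2) + MvPolynomial.C (1 / (2 * K)) *
      ∑ S : Finset (Fin N), MvPolynomial.C (cubeFourierCoeff (evalBool p) S) *
        ∑ i ∈ S, (1 - MvPolynomial.C 2 * MvPolynomial.X (Fin.castAdd N i)) *
          ∏ j ∈ S.erase i, (1 - MvPolynomial.C 2 * MvPolynomial.X (Fin.natAdd N j)) :
      MvPolynomial (Fin (N + N)) ℝ) x ≤ 1 := by
  rw [eq_append x, evalBool_decPoly_append]
  set t := ∑ S : Finset (Fin N), cubeFourierCoeff (evalBool p) S *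
    ∑ i ∈ S, sgn (x (Fin.castAdd N i)) * ∏ j ∈ S.erase i, sgn (x (Fin.natAdd N j)) with ht
  obtain ⟨h1, h2⟩ := abs_le.mp (hb (fun i => x (Fin.castAdd N i)) (fun j => x (Fin.natAdd N j)))
  have h2K : 0 < 2 * K := by linarith
  constructor
  · have : -(1 / 2 : ℝ) ≤ t / (2 * K) := by
      rw [le_div_iff₀ h2K]; linarith
    linarith
  · have : t / (2 * K) ≤ 1 / 2 := by
      rw [div_le_iff₀ h2K]; linarith
    linarith

/-- The decoupled shape: `decPoly p K (y,z) = 1/2 + Σ_i (±1)^{y_i} g_i(z)` with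
`g_i(z) = −(1/2K) Σ_{S∋i} p̂(S) Π_{j∈S∖i} sgn(z_j)` (note `sgn yᵢ = −(±1)^{yᵢ}` in the route's spelling).
[cite: ODonnellZhao2016, Def. 1.1] -/
theorem decPoly_decoupled (p : MvPolynomial (Fin N) ℝ) (K : ℝ) (y z : Fin N → Bool) :
    evalBool (MvPolynomial.C (1 / 2) + MvPolynomial.C (1 / (2 * K)) *
      ∑ S : Finset (Fin N), MvPolynomial.C (cubeFourierCoeff (evalBool p) S) *
        ∑ i ∈ S, (1 - MvPolynomial.C 2 * MvPolynomial.X (Fin.castAdd N i)) *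
          ∏ j ∈ S.erase i, (1 - MvPolynomial.C 2 * MvPolynomial.X (Fin.natAdd N j)) :
      MvPolynomial (Fin (N + N)) ℝ) (Fin.append y z) =
      1 / 2 + ∑ i, (if y i then (1 : ℝ) else -1) *
        (-(∑ S : Finset (Fin N), if i ∈ S then cubeFourierCoeff (evalBool p) S *
            ∏ j ∈ S.erase i, sgn (z j) else 0) / (2 * K)) := by
  classical
  rw [evalBool_decPoly_append]
  congr 1
  -- swap the sums `Σ_S Σ_{i∈S}` ↦ `Σ_i Σ_{S∋i}`
  have hswap : ∑ S : Finset (Fin N), cubeFourierCoeff (evalBool p) S *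
        ∑ i ∈ S, sgn (y i) * ∏ j ∈ S.erase i, sgn (z j) =
      ∑ i, sgn (y i) * ∑ S : Finset (Fin N), (if i ∈ S then cubeFourierCoeff (evalBool p) S *
          ∏ j ∈ S.erase i, sgn (z j) else 0) := by
    have h1 : ∀ S : Finset (Fin N), cubeFourierCoeff (evalBool p) S *
        ∑ i ∈ S, sgn (y i) * ∏ j ∈ S.erase i, sgn (z j) =
        ∑ i, sgn (y i) * (if i ∈ S then cubeFourierCoeff (evalBool p) S *
          ∏ j ∈ S.erase i, sgn (z j) else 0) := by
      intro S
      rw [Finset.mul_sum, ← Finset.sum_filter_add_sum_filter_not Finset.univ (fun i => i ∈ S)]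
      have hf : Finset.univ.filter (fun i : Fin N => i ∈ S) = S := by ext i; simp
      have hnf : ∑ i ∈ Finset.univ.filter (fun i : Fin N => ¬ i ∈ S), sgn (y i) *
          (if i ∈ S then cubeFourierCoeff (evalBool p) S * ∏ j ∈ S.erase i, sgn (z j) else 0) = 0 :=
        Finset.sum_eq_zero fun i hi => by
          rw [Finset.mem_filter] at hi
          rw [if_neg hi.2, mul_zero]
      rw [hf, hnf, add_zero]
      refine Finset.sum_congr rfl fun i hi => ?_
      rw [if_pos hi]; ring
    simp_rw [h1]
    rw [Finset.sum_comm]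
    refine Finset.sum_congr rfl fun i _ => ?_
    rw [Finset.mul_sum]
  rw [hswap, Finset.sum_div]
  refine Finset.sum_congr rfl fun i _ => ?_
  rw [sgn_eq_neg_ite]
  ring

end StubRealisation

open StubRealisation in
/-- **Stub `stub_realisation` of line `odonnell-zhao`** (registered signature, BY NAME): for `K > 0`,
`p.totalDegree ≤ d` and `|dec p| ≤ K` on the cube, the function `1/2 + dec p/(2K)` is the cube function of a
`[0,1]`-bounded, one-block-decoupled polynomial on `Fin (N+N)` of total degree `≤ d` — the realisation step
in O'Donnell–Zhao's proof of their Thm. 2.13 (`q = (1 + f̃/C_d)/2`). Witness: the inline `decPoly` of this file.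
[cite: ODonnellZhao2016, Def. 1.1 and proof of Thm. 2.13] -/
theorem stub_realisation :
    ∀ (N d : ℕ) (p : MvPolynomial (Fin N) ℝ) (C : ℝ), 0 < C → p.totalDegree ≤ d →
      (∀ (y z : Fin N → Bool),
        |∑ S : Finset (Fin N), cubeFourierCoeff (evalBool p) S *
            ∑ i ∈ S, sgn (y i) * ∏ j ∈ S.erase i, sgn (z j)| ≤ C) →
      ∃ q : MvPolynomial (Fin (N + N)) ℝ, q.totalDegree ≤ d ∧
        (∀ (y z : Fin N → Bool), evalBool q (Fin.append y z) =
          1 / 2 + (∑ S : Finset (Fin N), cubeFourierCoeff (evalBool p) S *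
            ∑ i ∈ S, sgn (y i) * ∏ j ∈ S.erase i, sgn (z j)) / (2 * C)) ∧
        (∀ x, 0 ≤ evalBool q x ∧ evalBool q x ≤ 1) ∧
        (∃ (c₀ : ℝ) (g : Fin N → (Fin N → Bool) → ℝ), ∀ (y z : Fin N → Bool),
          evalBool q (Fin.append y z) = c₀ + ∑ i, (if y i then (1 : ℝ) else -1) * g i z) := by
  intro N d p K hK hdeg hb
  refine ⟨_, totalDegree_decPoly_le hdeg K, evalBool_decPoly_append p K,
    decPoly_bounds hK hb, 1 / 2,
    fun i z => -(∑ S : Finset (Fin N), if i ∈ S then cubeFourierCoeff (evalBool p) S *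
      ∏ j ∈ S.erase i, sgn (z j) else 0) / (2 * K),
    decPoly_decoupled p K⟩

end Summit.QuantumAdvantage.QuantumAdvantage.Cruxes.OneBlockDecoupling.OdonnellZhao

end
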